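import Summits.QuantumFields.BalabanUV.T4Continuum.Support.NE7HierarchicalRepresentative
import Summits.QuantumFields.BalabanUV.T4Continuum.Support.NE7LevelMassBudgetAdd
import HarnessLib

/-!
# NE7HierarchicalBudget — THE ROOT-FORM LEVEL-MASS BUDGET ON THE HIERARCHICAL REPRESENTATIVE (route (H′) assembled up to the slice masses and the energies):
# for the representative `X′_i = X_i + gaugeDir W_i ν_i` of ✓ `hierarchical_representative` (exact curved lifts, one-level slice fluctuations `J_i`),
# **`Σ_{i≤m} 8^{−(m−i)}·dirSq X′_i [0,Q_i)⁴ ≤ (2C̄²∕(1 − ρ²∕8))·(ρ²·dirSq X′_{m+1} [0,Q_{m+1})⁴ + 2·Σ_{k≤m} (ρ∕8)^{m−k}·dirSq J_k [0,Q_k)⁴)`**, `ρ² = 7.197 < 8`,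
# `C̄ = (Kmain+Dgauge)·exp(((Kmain+Dgauge)∕ρ)·Σ_{j≤m} etaW(x_j,b_j))` — j-UNIFORM given a bounded sum of radii (d = 4, L = 2)
# (lineage `b2b-balaban-t4-ne7b-p1`, gen 163; route (H′), memo `t4/b2b-balaban-t4-ne7b-p1/g162/records/SCOPING-LEVELMASSES.md` §8 + `g163/records/SCOPING-R4.md`)

Cell `pub-balaban`, rung (B)+1 sub-cell t4, lineage `b2b-balaban-t4-ne7b-p1` (row NE7b OWNER + CRUX PROVER; junction service for row NE7 on ROAD-G116 §6 (G3) ∕ the ℓ² route to (G′)),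
generation 163.  Inputs BY NAME: ✓ `hierarchical_representative` (the recursion `X′_i = (r+δ)_i X′_{i+1} + J_i`), ✓ `curved_composite_le` ((C_W), the composite letters), ✓
`levelMassBudget_of_growth_add` (the root-form budget for additive lifts), `two_le_rho`, `rho_sq_lt`.
WHAT ([folklore]; DATA def `Cbar`; 0 sorry): `compA_self`, `compA_left`, `sum_etaTower_window_le`, **`hierarchical_budget`**.
WHAT IS NOT HERE: the slice masses `dirSq J_k ≤ C_P·4·curlSq_{W_k} J_k` (row NE3's slice Poincaré SHAPE, ✓ `sliceStep_letters`) and the energies (road G5) — the (G3′) assembly with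
✓ p834121 `multiplierTerm_le_levelMasses` is the road's∕successor's; the bondwise radii `b_i` remain DISPLAYED.
HONEST FRAMING (page 1): bookkeeping over kernel theorems about OUR objects; constants astronomical; nothing of Bałaban's asserted; NOT (G3), NOT (G′), NOT NE7∕NE3 as spine nodes; row NE7b
NOT PRINTED ∕ NOT PROVED; spine 0∕9; finite T⁴ rung (B)+1 — NOT infinite volume, NOT mass gap, NOT BetaPertH, NOT Clay.
-/

set_option autoImplicit false

open scoped BigOperators Matrix Matrix.Norms.L2Operator
open Finset

namespace Summit.QuantumFields.BalabanUV.T4Continuum.NE7HierarchicalBudget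

open Literature.MathematicalPhysics.QuantumFieldTheory.Balaban1983to89
open B7Prop1Explicit
open T4AveragingDeficitWall (IsUnitaryCfg IsSkewDir dirSq)
open T4AveragingDeficitWallBoundary (IsPeriodicCfg periodBox)
open AveragingDeficitPeriodicCounting (IsPeriodicDir)
open AveragingDeficitMultiLevelPrep (cpush tower)
open AveragingDeficitChartCalculus (cavg)
open BlockAveragePushDirGauge (gaugeDir isPeriodicDir_gaugeDir)
open NE3LandauOrbit (gaugeDir_skew)
open NE3FrameFreeSliceW (frameFreeBlockLandauW)
open NE7PerturbedCompositesAdd (compA compA_succ_apply)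
open NE7ExactLiftComposites (rho rho_nonneg two_le_rho rho_sq_lt Kmain Dgauge Kmain_nonneg Dgauge_nonneg)
open NE7CurvedExactLift (etaW etaW_nonneg)
open NE7CurvedExactLiftComposites (Qper Qper_succ TowerHyps rTower dTower etaTower curved_composite_le)
open NE7HierarchicalRepresentative (RepOn hierarchical_representative)
open NE7LevelMassBudgetAdd (levelMassBudget_of_growth_add)

noncomputable section

variable {n : Type*} [Fintype n] [DecidableEq n] [Nonempty n]
variable {P T : ℕ} [NeZero P] {W : ℕ → Site 4 → Fin 4 → (Matrix n n ℂ)ˣ} {x b : ℕ → ℝ}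

/-! ## §1 Composites as the budget's `R i k` -/

section Comp

variable {V : Type*} [AddCommGroup V] (f : ℕ → V →+ V)

/-- `compA f k (k − k) = id`. [folklore] -/
theorem compA_self (k : ℕ) : compA f k (k - k) = AddMonoidHom.id V := by rw [Nat.sub_self]; rfl

/-- `f i ∘ compA f (i+1) (k − (i+1)) = compA f i (k − i)` for `i < k`. [folklore] -/
theorem compA_left {i k : ℕ} (h : i < k) : (f i).comp (compA f (i + 1) (k - (i + 1))) = compA f i (k - i) := by
  rw [show k - i = (k - (i + 1)) + 1 by omega]; rfl

end Comp

omit [NeZero P] in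
/-- The window sums of the perturbation sizes are bounded by the full sum. [folklore] -/
theorem sum_etaTower_window_le (H : TowerHyps n P T W x b) {i t : ℕ} (hit : i + t ≤ T) :
    ∑ j ∈ range t, etaTower (n := n) x b T (i + j) ≤ ∑ j ∈ range T, etaTower (n := n) x b T j := by
  have hη : ∀ j, 0 ≤ etaTower (n := n) x b T j := fun j => by
    simp only [etaTower]; split_ifs with hj
    · exact etaW_nonneg (H.hx j hj) (H.hb j hj)
    · exact le_rfl
  rw [show ∑ j ∈ range t, etaTower (n := n) x b T (i + j) = ∑ j ∈ Ico i (i + t), etaTower (n := n) x b T j by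
    rw [Finset.sum_Ico_eq_sum_range, Nat.add_sub_cancel_left]]
  exact Finset.sum_le_sum_of_subset_of_nonneg (fun j hj => by have := Finset.mem_Ico.mp hj; exact Finset.mem_range.mpr (by omega)) fun j _ _ => hη j

/-- **THE UNIFORM COMPOSITE CONSTANT** `C̄ = (Kmain+Dgauge)·exp(((Kmain+Dgauge)∕ρ)·Σ_{j<T} η_j)`. [folklore] -/
def Cbar (n : Type*) [Fintype n] (x b : ℕ → ℝ) (T : ℕ) : ℝ :=
  (Kmain n + Dgauge n) * Real.exp (((Kmain n + Dgauge n) / rho) * ∑ j ∈ range T, etaTower (n := n) x b T j)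

/-! ## §2 The budget on the representative -/

/-- **THE ROOT-FORM LEVEL-MASS BUDGET ON THE HIERARCHICAL REPRESENTATIVE** (`d = 4`, `L = 2`, top index `m + 1`): for tower data `H`, consecutive backgrounds, a unitary
`Q_{m+1}`-periodic top background and an original tower `X` of skew periodic fields, there are `ν`, `J` with ✓ `RepOn H X 0 ν J` AND
`Σ_{i≤m} (8⁻¹)^{m−i}·dirSq (X_i + gaugeDir W_i ν_i) [0,Q_i)⁴ ≤ (2C̄²∕(1 − 8⁻¹ρ²))·(ρ²·dirSq (X_{m+1} + gaugeDir W_{m+1} ν_{m+1}) [0,Q_{m+1})⁴ + 2·Σ_{k≤m} (8⁻¹ρ)^{m−k}·dirSq J_k [0,Q_k)⁴)`. [folklore] -/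
theorem hierarchical_budget {m : ℕ} (H : TowerHyps n P (m + 1) W x b) (hcavg : ∀ i, i < m + 1 → W (i + 1) = cavg 2 (W i)) (hWT : IsUnitaryCfg (W (m + 1)))
    (hWTP : IsPeriodicCfg (W (m + 1)) (Qper P (m + 1) (m + 1) : ℤ))
    {X : ℕ → Site 4 → Fin 4 → Matrix n n ℂ} (hXs : ∀ i, i ≤ m + 1 → IsSkewDir (X i)) (hXP : ∀ i, i ≤ m + 1 → IsPeriodicDir (X i) (Qper P (m + 1) i : ℤ))
    (hX : ∀ i, i < m + 1 → X (i + 1) = cpush 2 (W i) (X i)) :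
    ∃ (ν : ℕ → Site 4 → Matrix n n ℂ) (J : ℕ → Site 4 → Fin 4 → Matrix n n ℂ), RepOn H X 0 ν J ∧
      ∑ i ∈ range (m + 1), ((((2 : ℕ) : ℝ) ^ 3)⁻¹) ^ (m - i) * dirSq (X i + gaugeDir (W i) (ν i)) (periodBox (d := 4) (Qper P (m + 1) i))
        ≤ (2 * Cbar n x b (m + 1) ^ 2 / (1 - (((2 : ℕ) : ℝ) ^ 3)⁻¹ * rho ^ 2))
          * (rho ^ 2 * dirSq (X (m + 1) + gaugeDir (W (m + 1)) (ν (m + 1))) (periodBox (d := 4) (Qper P (m + 1) (m + 1)))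
            + 2 * ∑ k ∈ range (m + 1), ((((2 : ℕ) : ℝ) ^ 3)⁻¹ * rho) ^ (m - k) * dirSq (J k) (periodBox (d := 4) (Qper P (m + 1) k))) := by
  obtain ⟨ν, J, hrep⟩ := hierarchical_representative H hcavg hWT hXs hXP hX
  refine ⟨ν, J, hrep, ?_⟩
  obtain ⟨htop, hinv, hsamp, hrec⟩ := hrep
  set f : ℕ → (Site 4 → Fin 4 → Matrix n n ℂ) →+ (Site 4 → Fin 4 → Matrix n n ℂ) := rTower (n := n) P (m + 1) + dTower H with hf
  set X' : ℕ → Site 4 → Fin 4 → Matrix n n ℂ := fun i => X i + gaugeDir (W i) (ν i) with hX'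
  -- the composite constant and its positivity
  have hKD : 0 ≤ Kmain n + Dgauge n := add_nonneg Kmain_nonneg Dgauge_nonneg
  have hCb0 : 0 ≤ Cbar n x b (m + 1) := mul_nonneg hKD (Real.exp_pos _).le
  -- the composite letter with the uniform constant
  have hcomp : ∀ (i t : ℕ), i + t ≤ m + 1 → ∀ u : Site 4 → Fin 4 → Matrix n n ℂ, IsSkewDir u → IsPeriodicDir u (Qper P (m + 1) (i + t) : ℤ) →
      Real.sqrt (dirSq (compA f i t u) (periodBox (d := 4) (Qper P (m + 1) i))) ≤ Cbar n x b (m + 1) * rho ^ t * Real.sqrt (dirSq u (periodBox (d := 4) (Qper P (m + 1) (i + t)))) := by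
    intro i t hit u hu huP
    have h := curved_composite_le H t i hit hu huP
    refine h.trans (mul_le_mul_of_nonneg_right (mul_le_mul_of_nonneg_right ?_ (pow_nonneg rho_nonneg t)) (Real.sqrt_nonneg _))
    unfold Cbar
    refine mul_le_mul_of_nonneg_left (Real.exp_le_exp.mpr ?_) hKD
    exact mul_le_mul_of_nonneg_left (sum_etaTower_window_le H hit) (div_nonneg hKD rho_nonneg)
  -- goodness of the data: top field and slice elements
  have hνT := hinv (m + 1) (Nat.zero_le _) le_rfl
  have hvS : IsSkewDir (X' (m + 1)) := fun y μ => (skewAdjoint _).add_mem (hXs (m + 1) le_rfl y μ) (gaugeDir_skew hWT hνT.1 y μ)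
  have hvP : IsPeriodicDir (X' (m + 1)) (Qper P (m + 1) (m + 1) : ℤ) := fun y k μ => by
    simp only [hX', Pi.add_apply, hXP (m + 1) le_rfl y k μ, isPeriodicDir_gaugeDir hWTP hνT.2 y k μ]
  have hJS : ∀ k, k < m + 1 → IsSkewDir (J k) := fun k hk => (hrec k (Nat.zero_le _) hk).1.1
  have hJP : ∀ k, k < m + 1 → IsPeriodicDir (J k) (Qper P (m + 1) k : ℤ) := fun k hk => by
    have h := (hrec k (Nat.zero_le _) hk).1.2.1
    rw [show (((tower 2 (Qper P (m + 1) (k + 1)) 1 : ℕ) : ℤ)) = (Qper P (m + 1) k : ℤ) by simp [tower, Qper_succ hk]] at h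
    exact h
  -- apply the additive budget
  have hB := levelMassBudget_of_growth_add (d := 4) (n := n) (L := 2) le_rfl two_le_rho rho_sq_lt m (fun i => periodBox (d := 4) (Qper P (m + 1) i))
    f (fun i k => compA f i (k - i)) (fun k => compA_self f k) (fun i k hik => compA_left f hik) X' J (X' (m + 1)) rfl
    (fun i hi => (hrec i (Nat.zero_le _) (by omega)).2.2)
    (fun i hi => by
      have h := hcomp i (m + 1 - i) (by omega) (X' (m + 1)) hvS (by rw [show i + (m + 1 - i) = m + 1 by omega]; exact hvP)
      rw [show i + (m + 1 - i) = m + 1 by omega] at h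
      exact h)
    (fun i k hik hkm => by
      have h := hcomp i (k - i) (by omega) (J k) (hJS k (by omega)) (by rw [show i + (k - i) = k by omega]; exact hJP k (by omega))
      rw [show i + (k - i) = k by omega] at h
      exact h)
  exact hB

end

end Summit.QuantumFields.BalabanUV.T4Continuum.NE7HierarchicalBudget
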